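import Literature.NumberTheory.EllipticCurves.CuspFormLFunctionEulerProductProofs
import HarnessLib

/-!
# The Euler product of the twisted `L`-series `L(f ⊗ χ, s)` of a newform on `Γ₀(N)`

Topic `Literature/NumberTheory/EllipticCurves`; THEOREMS ONLY (no definition, no named fact, net
literature debt `0`). Companion of `CuspFormLFunctionEulerProductProofs.lean` (the untwisted Euler
product `IsNewform0.hasProd_cuspFormLSeries_holds`) for the tree's twisted series
`twistedLSeries f χ s = ∑ χ(n) aₙ(f) n⁻ˢ` (`CuspFormLFunction.lean`).

For a newform `f = ∑ aₙ qⁿ ∈ S_k(Γ₀(N))` (`IsNewform0 f`), a Dirichlet character `χ` modulo any `m`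
and `re s > k/2 + 1`:

  `L(f ⊗ χ, s) = ∏_p (1 − χ(p) a_p p⁻ˢ + 𝟙_N(p) χ(p)² p^{k−1} p⁻²ˢ)⁻¹`

(Shimura, *Introduction to the arithmetic theory of automorphic functions*, Thm. 3.66: "`∑ χ(n) aₙ n⁻ˢ
= ∏_p (1 − χ(p) a_p p⁻ˢ + χ(p)² p^{k−1−2s})⁻¹`" for a primitive Hecke eigenform of level `N` and
trivial character, the factor `p^{k−1}` being absent for `p ∣ N`; Diamond–Shurman Thm. 5.9.2 is the
case `χ = 𝟙`). Proof exactly as the untwisted discharge: `n ↦ χ(n) aₙ` has `χ(1)a₁ = 1`, is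
multiplicative on coprime arguments and satisfies the prime-power recursion with
`e_p = 𝟙_N(p) p^{k−1} χ(p)²`, and `∑ χ(n) aₙ n⁻ˢ` converges absolutely where `∑ aₙ n⁻ˢ` does
(`|χ(n)| ≤ 1`); then `Literature.NumberTheory.Automorphic.LSeries_hasProd_of_recurrence`.

Also recorded (for the Euler-factor bookkeeping of the Artin formalism
`rankinSelbergEulerProductHecke_baseChangeDirichlet_eq`, `RankinSelbergBaseChangeDirichlet.lean`,
whose right-hand side is a product of two such series): the weight-`2` form in the currency of
`twistedLSeries_changeLevel_eq_prod_mul` (`e_p = 𝟙_N(p)·p`), the `tprod`/`Multipliable` forms, the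
Euler product of a product of two twists, and the local identity at an INERT prime
`(1 − a w X + e w² X²)(1 + a w X + e w² X²) = 1 − (a² − 2e) w² X² + e² w⁴ X⁴` (pure algebra).

Written by the literature seat of the cell `bsd-addord` (FULL-BSD rank-`≤ 1` programme; HOME
`run/shared/lean/pub/bsd-addord/`, `lit/DISCHARGE-PLAN-hArt-ArtinFormalism.md` step (S1)).

## References

* G. Shimura, *Introduction to the Arithmetic Theory of Automorphic Functions* (1971), Thm. 3.66.
  [Shimura1971]
* F. Diamond, J. Shurman, *A First Course in Modular Forms*, GTM 228 (2005), Prop. 5.8.5, Thm. 5.9.2,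
  §5.10. [DiamondShurman2005]
-/

noncomputable section

open scoped MatrixGroups ModularForm

open CongruenceSubgroup Complex

namespace Literature.NumberTheory.EllipticCurves.ModularForms

variable {N : ℕ} [NeZero N] {k : ℤ} {m : ℕ}

/-! ### The twisted coefficients `n ↦ χ(n) aₙ(f)` -/

/-- **Absolute convergence of the twisted series**: `∑ χ(n) aₙ(f) n⁻ˢ` converges absolutely for
`re s > k/2 + 1` (where `∑ aₙ n⁻ˢ` does, `LSeriesSummable_cuspCoeff_gamma0`), since `|χ(n)| ≤ 1`.
The weight-`2` case is `LSeriesSummable_dirichlet_mul_cuspCoeff`.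
[cite: DiamondShurman2005, Prop. 5.9.1 and §5.9 (absolute convergence for re s > k/2 + 1)] -/
theorem LSeriesSummable_dirichlet_mul_cuspCoeff_weight (f : CuspForm (Gamma0 N) k)
    (χ : DirichletCharacter ℂ m) {s : ℂ} (hs : (k : ℝ) / 2 + 1 < s.re) :
    LSeriesSummable (fun n ↦ χ n * cuspCoeff f n) s := by
  have h0 : LSeriesSummable (cuspCoeff f) s := LSeriesSummable_cuspCoeff_gamma0 f hs
  refine Summable.of_norm_bounded h0.norm fun n => LSeries.norm_term_le s ?_
  rw [norm_mul]
  exact mul_le_of_le_one_left (norm_nonneg _) (DirichletCharacter.norm_le_one χ _)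

/-- `χ(1) a₁(f) = 1` for a newform (normalised: `a₁ = 1`). [cite: DiamondShurman2005, Def. 5.8.1 (newforms are normalised)] -/
theorem IsNewform0.dirichlet_mul_cuspCoeff_one {f : CuspForm (Gamma0 N) k} (hf : IsNewform0 f)
    (χ : DirichletCharacter ℂ m) : χ (1 : ℕ) * cuspCoeff f 1 = 1 := by
  rw [show cuspCoeff f 1 = 1 from hf.2.2, Nat.cast_one, map_one, mul_one]

/-- The twisted coefficients are multiplicative on coprime arguments (Diamond–Shurman Prop. 5.8.5 (3)
for `aₙ`, and `χ` is multiplicative). [cite: DiamondShurman2005, Prop. 5.8.5] -/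
theorem IsNewform0.dirichlet_mul_cuspCoeff_mul_of_coprime {f : CuspForm (Gamma0 N) k}
    (hf : IsNewform0 f) (χ : DirichletCharacter ℂ m) {a b : ℕ} (hab : a.Coprime b) :
    χ ((a * b : ℕ) : ZMod m) * cuspCoeff f (a * b) =
      (χ (a : ZMod m) * cuspCoeff f a) * (χ (b : ZMod m) * cuspCoeff f b) := by
  have hmul : cuspCoeff f (a * b) = cuspCoeff f a * cuspCoeff f b :=
    IsNewform0.coeff_mul_of_coprime_holds hf hab
  rw [Nat.cast_mul, map_mul, hmul]
  ring

/-- **Prime-power recursion for the twisted coefficients**: with `bₙ = χ(n) aₙ(f)` and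
`e_p = 𝟙_N(p) p^{k−1} χ(p)²`, `b_{p^{r+2}} = b_p b_{p^{r+1}} − e_p b_{p^r}` (Diamond–Shurman Prop. 5.8.5
(2) for `aₙ`, times `χ(p)^{r+2}`). [cite: DiamondShurman2005, Prop. 5.8.5] -/
theorem IsNewform0.dirichlet_mul_cuspCoeff_prime_pow_add_two {f : CuspForm (Gamma0 N) k}
    (hf : IsNewform0 f) (χ : DirichletCharacter ℂ m) {p : ℕ} (hp : p.Prime) (r : ℕ) :
    χ ((p ^ (r + 2) : ℕ) : ZMod m) * cuspCoeff f (p ^ (r + 2)) =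
      (χ (p : ZMod m) * cuspCoeff f p) * (χ ((p ^ (r + 1) : ℕ) : ZMod m) * cuspCoeff f (p ^ (r + 1))) -
        ((if p ∣ N then 0 else (p : ℂ) ^ (k - 1)) * χ (p : ZMod m) ^ 2) *
          (χ ((p ^ r : ℕ) : ZMod m) * cuspCoeff f (p ^ r)) := by
  rw [hf.cuspCoeff_prime_pow_add_two_weight hp r, Nat.cast_pow, Nat.cast_pow, Nat.cast_pow, map_pow,
    map_pow, map_pow]
  ring

/-! ### The Euler product -/

/-- **Euler product of the twisted `L`-series, any weight** (Shimura 1971, Thm. 3.66): for a newform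
`f ∈ S_k(Γ₀(N))`, a Dirichlet character `χ` mod `m` and `re s > k/2 + 1`,
`L(f ⊗ χ, s) = ∏_p (1 − χ(p) a_p p⁻ˢ + 𝟙_N(p) p^{k−1} χ(p)² (p⁻ˢ)²)⁻¹`, the product over the primes
converging (`HasProd` over `Nat.Primes`). [cite: Shimura1971, Thm. 3.66]
[cite: DiamondShurman2005, Thm. 5.9.2 and its proof] -/
theorem IsNewform0.hasProd_twistedLSeries {f : CuspForm (Gamma0 N) k} (hf : IsNewform0 f)
    (χ : DirichletCharacter ℂ m) {s : ℂ} (hs : (k : ℝ) / 2 + 1 < s.re) :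
    HasProd (fun p : Nat.Primes ↦
      (1 - χ ((p : ℕ) : ZMod m) * cuspCoeff f p * (p : ℂ) ^ (-s) +
        (if (p : ℕ) ∣ N then 0 else (p : ℂ) ^ (k - 1)) * χ ((p : ℕ) : ZMod m) ^ 2 *
          ((p : ℂ) ^ (-s)) ^ 2)⁻¹)
      (twistedLSeries f χ s) := by
  have h := Automorphic.LSeries_hasProd_of_recurrence (a := fun n ↦ χ (n : ZMod m) * cuspCoeff f n)
    (e := fun p ↦ (if p ∣ N then 0 else (p : ℂ) ^ (k - 1)) * χ (p : ZMod m) ^ 2)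
    (hf.dirichlet_mul_cuspCoeff_one χ)
    (fun hab ↦ hf.dirichlet_mul_cuspCoeff_mul_of_coprime χ hab)
    (fun hp r ↦ hf.dirichlet_mul_cuspCoeff_prime_pow_add_two χ hp r)
    (LSeriesSummable_dirichlet_mul_cuspCoeff_weight f χ hs)
  exact h

/-- **Euler product of the twisted `L`-series, weight `2`**, in the currency of
`twistedLSeries_changeLevel_eq_prod_mul` (`e_p = 𝟙_N(p) · p`): for a newform `f ∈ S₂(Γ₀(N))`, `χ` mod
`m` and `re s > 2`, `L(f ⊗ χ, s) = ∏_p (1 − χ(p) a_p p⁻ˢ + 𝟙_N(p) p χ(p)² (p⁻ˢ)²)⁻¹`.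
[cite: Shimura1971, Thm. 3.66] -/
theorem IsNewform0.hasProd_twistedLSeries_two {f : CuspForm (Gamma0 N) 2} (hf : IsNewform0 f)
    (χ : DirichletCharacter ℂ m) {s : ℂ} (hs : 2 < s.re) :
    HasProd (fun p : Nat.Primes ↦
      (1 - χ ((p : ℕ) : ZMod m) * cuspCoeff f p * (p : ℂ) ^ (-s) +
        (if (p : ℕ) ∣ N then 0 else (p : ℂ)) * χ ((p : ℕ) : ZMod m) ^ 2 * ((p : ℂ) ^ (-s)) ^ 2)⁻¹)
      (twistedLSeries f χ s) := by
  have hs' : ((2 : ℤ) : ℝ) / 2 + 1 < s.re := by push_cast; linarith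
  have h := hf.hasProd_twistedLSeries χ hs'
  refine h.congr_fun fun p ↦ ?_
  by_cases hpN : (p : ℕ) ∣ N
  · simp only [if_pos hpN]
  · simp only [if_neg hpN]
    rw [show ((2 : ℤ) - 1) = 1 by norm_num, zpow_one]

/-- The twisted Euler product is multipliable (`re s > k/2 + 1`). [cite: Shimura1971, Thm. 3.66] -/
theorem IsNewform0.multipliable_twistedEulerFactor {f : CuspForm (Gamma0 N) k} (hf : IsNewform0 f)
    (χ : DirichletCharacter ℂ m) {s : ℂ} (hs : (k : ℝ) / 2 + 1 < s.re) :
    Multipliable (fun p : Nat.Primes ↦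
      (1 - χ ((p : ℕ) : ZMod m) * cuspCoeff f p * (p : ℂ) ^ (-s) +
        (if (p : ℕ) ∣ N then 0 else (p : ℂ) ^ (k - 1)) * χ ((p : ℕ) : ZMod m) ^ 2 *
          ((p : ℂ) ^ (-s)) ^ 2)⁻¹) :=
  (hf.hasProd_twistedLSeries χ hs).multipliable

/-- **`L(f ⊗ χ, s) = ∏'_p (…)⁻¹`** (`tprod` form of the Euler product, `re s > k/2 + 1`).
[cite: Shimura1971, Thm. 3.66] -/
theorem IsNewform0.twistedLSeries_eq_tprod {f : CuspForm (Gamma0 N) k} (hf : IsNewform0 f)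
    (χ : DirichletCharacter ℂ m) {s : ℂ} (hs : (k : ℝ) / 2 + 1 < s.re) :
    twistedLSeries f χ s = ∏' p : Nat.Primes,
      (1 - χ ((p : ℕ) : ZMod m) * cuspCoeff f p * (p : ℂ) ^ (-s) +
        (if (p : ℕ) ∣ N then 0 else (p : ℂ) ^ (k - 1)) * χ ((p : ℕ) : ZMod m) ^ 2 *
          ((p : ℂ) ^ (-s)) ^ 2)⁻¹ :=
  (hf.hasProd_twistedLSeries χ hs).tprod_eq.symm

/-- **Euler product of a product of two twists** (the right-hand side of the Artin formalism
`L(s, f_K ⊗ θ∘N) = L(f ⊗ θ, s) L(f ⊗ θκ, s)` as a product over rational primes), weight `2`,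
`re s > 2`: `L(f ⊗ χ₁, s) L(f ⊗ χ₂, s) = ∏_p (F_{χ₁}(p) F_{χ₂}(p))⁻¹` with
`F_χ(p) = 1 − χ(p) a_p p⁻ˢ + 𝟙_N(p) p χ(p)² (p⁻ˢ)²`. [cite: Shimura1971, Thm. 3.66] -/
theorem IsNewform0.hasProd_twistedLSeries_mul_twistedLSeries {f : CuspForm (Gamma0 N) 2}
    (hf : IsNewform0 f) {m₁ m₂ : ℕ} (χ₁ : DirichletCharacter ℂ m₁) (χ₂ : DirichletCharacter ℂ m₂)
    {s : ℂ} (hs : 2 < s.re) :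
    HasProd (fun p : Nat.Primes ↦
      (1 - χ₁ ((p : ℕ) : ZMod m₁) * cuspCoeff f p * (p : ℂ) ^ (-s) +
          (if (p : ℕ) ∣ N then 0 else (p : ℂ)) * χ₁ ((p : ℕ) : ZMod m₁) ^ 2 * ((p : ℂ) ^ (-s)) ^ 2)⁻¹ *
        (1 - χ₂ ((p : ℕ) : ZMod m₂) * cuspCoeff f p * (p : ℂ) ^ (-s) +
          (if (p : ℕ) ∣ N then 0 else (p : ℂ)) * χ₂ ((p : ℕ) : ZMod m₂) ^ 2 * ((p : ℂ) ^ (-s)) ^ 2)⁻¹)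
      (twistedLSeries f χ₁ s * twistedLSeries f χ₂ s) :=
  (hf.hasProd_twistedLSeries_two χ₁ hs).mul (hf.hasProd_twistedLSeries_two χ₂ hs)

/-! ### Local bookkeeping at an inert prime (pure algebra) -/

/-- **The local factor at an INERT prime of a quadratic field factors into the two twists**: with
`α + β = a`, `αβ = e` one has `α² + β² = a² − 2e`, and for any `w` (`= θ(ℓ)²` ↦ here `w²` with
`w = θ(ℓ)`) and `X` (`= ℓ⁻ˢ`):
`(1 − a w X + e w² X²)(1 + a w X + e w² X²) = 1 − (a² − 2e) w² X² + e² w⁴ X⁴` — the degree-`2` Euler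
factor of `f` over the inert prime (norm `ℓ²`, Frobenius trace `α² + β²`) against the Hecke value
`w²` equals the product of the `ℓ`-factors of `L(f ⊗ θ)` and `L(f ⊗ θκ)` with `κ(ℓ) = −1`
(Gross, *Heegner points and representation theory*, §3: `L(f, χ, s) = L(A₁, s) L(A₂, s)`).
[cite: Gross2004, §3 (p. 40)] -/
theorem inert_localFactor_mul {R : Type*} [CommRing R] (a e w X : R) :
    (1 - a * w * X + e * w ^ 2 * X ^ 2) * (1 + a * w * X + e * w ^ 2 * X ^ 2) =
      1 - (a ^ 2 - 2 * e) * w ^ 2 * X ^ 2 + e ^ 2 * w ^ 4 * X ^ 4 := by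
  ring

/-- The same identity read with `κ(ℓ) = −1` displayed: the second factor is the `ℓ`-factor of
`L(f ⊗ θκ)`, `1 − (θκ)(ℓ) a X + e (θκ)(ℓ)² X²` with `(θκ)(ℓ) = −w`. [cite: Gross2004, §3 (p. 40)] -/
theorem inert_localFactor_mul' {R : Type*} [CommRing R] (a e w X : R) :
    (1 - a * w * X + e * w ^ 2 * X ^ 2) * (1 - a * (-w) * X + e * (-w) ^ 2 * X ^ 2) =
      1 - (a ^ 2 - 2 * e) * w ^ 2 * X ^ 2 + e ^ 2 * w ^ 4 * X ^ 4 := by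
  ring

/-- **Split prime**: two primes of norm `ℓ`, each with the `ℓ`-factor of `L(f ⊗ θ)`; with `κ(ℓ) = 1`
the product of the two twists' factors is its square. [cite: Gross2004, §3 (p. 40)] -/
theorem split_localFactor_sq {R : Type*} [CommRing R] (a e w X : R) :
    (1 - a * w * X + e * w ^ 2 * X ^ 2) * (1 - a * (1 * w) * X + e * (1 * w) ^ 2 * X ^ 2) =
      (1 - a * w * X + e * w ^ 2 * X ^ 2) ^ 2 := by
  ring

end Literature.NumberTheory.EllipticCurves.ModularForms

end
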